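import Mathlib
import Summits.Ventures.PercRepro2.TriDisagreementPinned

/-!
# Splitting a typed three-copy count over the typed edges of a part: per-copy pinned counts
(blind cell PercRepro2, night-3 g28, 2026-08-29; `proofs/NIGHT3-CERT.md` §37.6 / §36.2)

`typedCount (F ∪ S) z τ K` (TriDisagreementPinned: the typed 3-colouring count with types `τ` on the typed
edges and the base `z` elsewhere) sums over the three copies' configurations on `F ∪ S`.  Grouping the
triples by their restrictions `(a, b, c)` to the edge set `S` (the edges of an unmarked PART — a star at a
new vertex, a bundle, …), every group is a three-copy count on `F` alone in which copy `i` is pinned, off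
`F`, to the base `z` overwritten on `S` by its own part configuration — the **per-copy pinned count**
`typedCount3 F z₁ z₂ z₃ τ K`.  THEOREM `typedCount_split`: for `F`, `S` disjoint,

  `typedCount (F ∪ S) z τ K = Σ_{a b c supported on S, openCount a b c = τ on S}
                                 typedCount3 F (setOn S a z) (setOn S b z) (setOn S c z) τ K`.

This is the bookkeeping half of the gadget-law method (§36.2): the typed base of core + part is the
part's typed assignment law contracted with the core's per-copy-pinned table, with NO connectivity
argument — the connectivity fact (the pinned count depends on the part configurations only through the
partitions of the terminals they induce) is not needed to state or use the certificate of §37.6, which can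
be read directly on the `(2^|S|)^3`-state table.  Own work; standard axioms.
-/

namespace Summit.Ventures.PercRepro2

namespace TypedStar

variable {E : Type*} [Fintype E] [DecidableEq E] {R : Type*} [CommRing R]

/-- The restriction of a configuration to the edges of `S` (closed off `S`). -/
def restrictTo (S : Finset E) (ω : Config E) : Config E := fun e => ω e && decide (e ∈ S)

/-- The base `z` overwritten on `S` by `a`. -/
def setOn (S : Finset E) (a z : Config E) : Config E := fun e => if e ∈ S then a e else z e

/-- A configuration supported on `S`. -/
abbrev SuppOn (S : Finset E) (a : Config E) : Prop := ∀ e, a e = true → e ∈ S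

/-- **The per-copy pinned typed count**: copy `i` agrees with `zᵢ` off `F`, open counts `τ` on `F`. -/
def typedCount3 (F : Finset E) (z₁ z₂ z₃ : Config E) (τ : E → ℕ)
    (K : Config E → Config E → Config E → R) : R :=
  ∑ x : Config E, ∑ y : Config E, ∑ w : Config E,
    if (∀ e, e ∉ F → x e = z₁ e ∧ y e = z₂ e ∧ w e = z₃ e) ∧ (∀ e ∈ F, openCount x y w e = τ e)
      then K x y w else 0

omit [Fintype E] in
/-- On `S` the restriction agrees with `ω`. -/
lemma restrictTo_of_mem {S : Finset E} {e : E} (he : e ∈ S) (ω : Config E) : restrictTo S ω e = ω e := by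
  simp [restrictTo, he]

omit [Fintype E] in
/-- Off `S` the restriction is closed. -/
lemma restrictTo_of_not_mem {S : Finset E} {e : E} (he : e ∉ S) (ω : Config E) :
    restrictTo S ω e = false := by
  simp [restrictTo, he]

omit [Fintype E] in
/-- The restriction to `S` is supported on `S`. -/
lemma suppOn_restrictTo (S : Finset E) (ω : Config E) : SuppOn S (restrictTo S ω) := by
  intro e he
  by_contra h
  rw [restrictTo_of_not_mem h] at he
  exact Bool.false_ne_true he

omit [Fintype E] in
/-- On `S` the overwritten base is `a`. -/
lemma setOn_of_mem {S : Finset E} {e : E} (he : e ∈ S) (a z : Config E) : setOn S a z e = a e := by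
  simp [setOn, he]

omit [Fintype E] in
/-- Off `S` the overwritten base is `z`. -/
lemma setOn_of_not_mem {S : Finset E} {e : E} (he : e ∉ S) (a z : Config E) : setOn S a z e = z e := by
  simp [setOn, he]

omit [Fintype E] in
/-- On `S` the open count of the restrictions is the open count. -/
lemma openCount_restrictTo {S : Finset E} {e : E} (he : e ∈ S) (x y w : Config E) :
    openCount (restrictTo S x) (restrictTo S y) (restrictTo S w) e = openCount x y w e := by
  simp only [openCount, restrictTo_of_mem he]

omit [Fintype E] in
/-- A configuration supported on `S` that agrees with `x` on `S` is the restriction of `x`. -/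
lemma eq_restrictTo_of_suppOn {S : Finset E} {a x : Config E} (ha : SuppOn S a)
    (hx : ∀ e ∈ S, x e = a e) : a = restrictTo S x := by
  funext e
  by_cases he : e ∈ S
  · rw [restrictTo_of_mem he, hx e he]
  · rw [restrictTo_of_not_mem he]
    cases h : a e
    · rfl
    · exact absurd (ha e h) he

omit [Fintype E] in
/-- The condition of the outer sum (part configurations typed `τ` on `S`) together with the condition of
the inner pinned sum is equivalent to: `(a, b, c)` are the restrictions of `(x, y, w)` and `(x, y, w)`
satisfies the condition of `typedCount (F ∪ S) z τ K`. -/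
lemma cond_iff {F S : Finset E} (hd : Disjoint F S) (z : Config E) (τ : E → ℕ) (a b c x y w : Config E) :
    (((SuppOn S a ∧ SuppOn S b ∧ SuppOn S c) ∧ (∀ e ∈ S, openCount a b c e = τ e)) ∧
        ((∀ e, e ∉ F → x e = setOn S a z e ∧ y e = setOn S b z e ∧ w e = setOn S c z e) ∧
          (∀ e ∈ F, openCount x y w e = τ e))) ↔
      ((a = restrictTo S x ∧ b = restrictTo S y ∧ c = restrictTo S w) ∧
        ((∀ e, e ∉ F ∪ S → x e = z e ∧ y e = z e ∧ w e = z e) ∧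
          (∀ e ∈ F ∪ S, openCount x y w e = τ e))) := by
  constructor
  · rintro ⟨⟨⟨ha, hb, hc⟩, hS⟩, hoff, hF⟩
    have hnotF : ∀ e ∈ S, e ∉ F := fun e he hF' => Finset.disjoint_left.mp hd hF' he
    have hxa : ∀ e ∈ S, x e = a e := fun e he => by
      have := (hoff e (hnotF e he)).1; rwa [setOn_of_mem he] at this
    have hyb : ∀ e ∈ S, y e = b e := fun e he => by
      have := (hoff e (hnotF e he)).2.1; rwa [setOn_of_mem he] at this
    have hwc : ∀ e ∈ S, w e = c e := fun e he => by
      have := (hoff e (hnotF e he)).2.2; rwa [setOn_of_mem he] at this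
    refine ⟨⟨eq_restrictTo_of_suppOn ha hxa, eq_restrictTo_of_suppOn hb hyb, eq_restrictTo_of_suppOn hc hwc⟩,
      ?_, ?_⟩
    · intro e he
      have heF : e ∉ F := fun h => he (Finset.mem_union_left _ h)
      have heS : e ∉ S := fun h => he (Finset.mem_union_right _ h)
      have := hoff e heF
      rwa [setOn_of_not_mem heS, setOn_of_not_mem heS, setOn_of_not_mem heS] at this
    · intro e he
      rcases Finset.mem_union.mp he with h | h
      · exact hF e h
      · have h1 := hS e h
        simp only [openCount, hxa e h, hyb e h, hwc e h]
        simpa only [openCount] using h1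
  · rintro ⟨⟨rfl, rfl, rfl⟩, hoff, hFS⟩
    refine ⟨⟨⟨suppOn_restrictTo S x, suppOn_restrictTo S y, suppOn_restrictTo S w⟩, ?_⟩, ?_, ?_⟩
    · intro e he
      rw [openCount_restrictTo he]
      exact hFS e (Finset.mem_union_right _ he)
    · intro e he
      by_cases hS : e ∈ S
      · simp only [setOn_of_mem hS, restrictTo_of_mem hS, and_self]
      · have := hoff e (fun h => (Finset.mem_union.mp h).elim he hS)
        simpa only [setOn_of_not_mem hS] using this
    · intro e he
      exact hFS e (Finset.mem_union_left _ he)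

/-- The unique-witness sum: for fixed `(x, y, w)`, exactly one part triple `(a, b, c)` — the restrictions —
contributes. -/
lemma sum_part_eq {F S : Finset E} (hd : Disjoint F S) (z : Config E) (τ : E → ℕ)
    (K : Config E → Config E → Config E → R) (x y w : Config E) :
    (∑ p : Config E × Config E × Config E,
      if ((SuppOn S p.1 ∧ SuppOn S p.2.1 ∧ SuppOn S p.2.2) ∧ (∀ e ∈ S, openCount p.1 p.2.1 p.2.2 e = τ e)) ∧
          ((∀ e, e ∉ F → x e = setOn S p.1 z e ∧ y e = setOn S p.2.1 z e ∧ w e = setOn S p.2.2 z e) ∧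
            (∀ e ∈ F, openCount x y w e = τ e)) then K x y w else 0) =
      if (∀ e, e ∉ F ∪ S → x e = z e ∧ y e = z e ∧ w e = z e) ∧ (∀ e ∈ F ∪ S, openCount x y w e = τ e)
        then K x y w else 0 := by
  rw [Finset.sum_eq_single (restrictTo S x, restrictTo S y, restrictTo S w)]
  · simp only [cond_iff hd z τ, true_and]
  · intro p _ hp
    rw [if_neg]
    intro hc
    apply hp
    have := (cond_iff hd z τ p.1 p.2.1 p.2.2 x y w).mp hc
    obtain ⟨⟨h1, h2, h3⟩, _⟩ := this
    exact Prod.ext h1 (Prod.ext h2 h3)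
  · intro h
    exact absurd (Finset.mem_univ _) h

/-- A triple sum over configurations as one sum over the product type. -/
lemma flatten3 (g : Config E → Config E → Config E → R) :
    (∑ a : Config E, ∑ b : Config E, ∑ c : Config E, g a b c) =
      ∑ p : Config E × Config E × Config E, g p.1 p.2.1 p.2.2 := by
  simp only [Fintype.sum_prod_type]

/-- Moving an outer sum past three inner sums. -/
lemma sum_comm_out {P : Type*} [Fintype P] (f : P → Config E → Config E → Config E → R) :
    (∑ p : P, ∑ x : Config E, ∑ y : Config E, ∑ w : Config E, f p x y w) =
      ∑ x : Config E, ∑ y : Config E, ∑ w : Config E, ∑ p : P, f p x y w := by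
  rw [Finset.sum_comm]
  refine Finset.sum_congr rfl fun x _ => ?_
  rw [Finset.sum_comm]
  refine Finset.sum_congr rfl fun y _ => ?_
  rw [Finset.sum_comm]

/-- **Splitting a typed count over the typed edges of a part.** -/
theorem typedCount_split {F S : Finset E} (hd : Disjoint F S) (z : Config E) (τ : E → ℕ)
    (K : Config E → Config E → Config E → R) :
    typedCount (F ∪ S) z τ K =
      ∑ a : Config E, ∑ b : Config E, ∑ c : Config E,
        if (SuppOn S a ∧ SuppOn S b ∧ SuppOn S c) ∧ (∀ e ∈ S, openCount a b c e = τ e)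
          then typedCount3 F (setOn S a z) (setOn S b z) (setOn S c z) τ K else 0 := by
  -- push the outer condition inside the inner sums
  have step : ∀ a b c : Config E,
      (if (SuppOn S a ∧ SuppOn S b ∧ SuppOn S c) ∧ (∀ e ∈ S, openCount a b c e = τ e)
        then typedCount3 F (setOn S a z) (setOn S b z) (setOn S c z) τ K else 0) =
      ∑ x : Config E, ∑ y : Config E, ∑ w : Config E,
        (if ((SuppOn S a ∧ SuppOn S b ∧ SuppOn S c) ∧ (∀ e ∈ S, openCount a b c e = τ e)) ∧
            ((∀ e, e ∉ F → x e = setOn S a z e ∧ y e = setOn S b z e ∧ w e = setOn S c z e) ∧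
              (∀ e ∈ F, openCount x y w e = τ e)) then K x y w else 0) := by
    intro a b c
    unfold typedCount3
    by_cases h : (SuppOn S a ∧ SuppOn S b ∧ SuppOn S c) ∧ (∀ e ∈ S, openCount a b c e = τ e)
    · rw [if_pos h]
      refine Finset.sum_congr rfl fun x _ => Finset.sum_congr rfl fun y _ => Finset.sum_congr rfl fun w _ => ?_
      exact (if_congr (and_iff_right h) rfl rfl).symm
    · rw [if_neg h]
      symm
      refine Finset.sum_eq_zero fun x _ => Finset.sum_eq_zero fun y _ => Finset.sum_eq_zero fun w _ => ?_
      exact if_neg (fun hc => h hc.1)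
  rw [Finset.sum_congr rfl (fun a _ => Finset.sum_congr rfl (fun b _ =>
    Finset.sum_congr rfl (fun c _ => step a b c)))]
  rw [flatten3, sum_comm_out]
  unfold typedCount
  refine Finset.sum_congr rfl fun x _ => Finset.sum_congr rfl fun y _ => Finset.sum_congr rfl fun w _ => ?_
  exact (sum_part_eq hd z τ K x y w).symm

end TypedStar

end Summit.Ventures.PercRepro2
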